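import Literature.MathematicalPhysics.QuantumFieldTheory.BalabanImbrieJaffe1984to88.BIJ88Eq528Density
import Literature.MathematicalPhysics.QuantumFieldTheory.BalabanImbrieJaffe1984to88.BIJ88RT51BlockGauge

/-!
# `BalabanImbrieJaffe1984to88.BIJ88RT52BlockGauge` — T. Bałaban, J. Imbrie, A. Jaffe, *Effective action and cluster properties of the
abelian Higgs model*, Commun. Math. Phys. **114** (1988) 257–315 [BalabanImbrieJaffe1988], (5.2.9) p. 279 [PDF 23] (with (4.17) p. 277
[PDF 21]): *"This restricted gauge invariance we intend to preserve in all subsequent operations. For example, it is easily seen that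
the characteristic functions we have inserted are invariant."* — PROVED AT MEASURE LEVEL for the operation of Sect. 5.2: the block field
gauge COVARIANCE of the `ψ`-dependent density display `IsRD` (file `BIJ88RT52Restrictions`, the shape of (5.2.8)) under the joint
transformation `(u, {u^{(j)}}, φ, ψ; v) ↦ (u^{g∘y}, τ{u^{(j)}}, (g∘y)φ, gψ; v^g)` of (5.2.9)/(4.17), and the INVARIANCE of the printed
characteristic functions `χ_x, χ_y, χ_b, χ_p` of (5.2.2) and of the weights `ζ_{Λ₀^{(k)c}} χ_{Λ₀^{(k)}}` of (5.2.7) under it (file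
`BIJ88Eq528Density`'s `chi522`, `weight527`) — so the (5.2.8) density transforms as in (5.2.9).  (File 3 of seat p34 gen 8; the `ψ`-constant
case is gen 5's `BIJ88RT51BlockGauge.isRT511(Ax)_blockGauge`.)

statement-level skeleton of published theorems with citation tags; proofs where landed; nothing here is a claim about the Yang–Mills mass gap

PDF held: `paper:balaban1988-cmp114-bij-abelian-higgs-effective-action` (journal page = PDF page + 256); pp. 277–279 [PDF 21–23] read
(`lit read … --pages 21-25`; r16's render `HOME/lit-balaban-r16/renders/cmp114/original-p022-x2.png`).

CITATION HEADER (lean-in-tree rule).  Part of the lit-balaban TYPED SKELETON (HOME `run/shared/lean/pub/lit-balaban/`), PHASE-2 proof seat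
p34 gen 8 (unit `lit-balaban-p34-g8`; TAKING line HOME/STATUS.md 2026-08-21T19:07:49Z; own lineage = the C1/C2 renormalization-transformation
line).  Rows served (support): **`C2.Eq5.2.9`** (owner r16; typed `BIJ88Sect5StatementsPart3.Invariant529` + `invariant529_chiX/_chiP`; gen 5's
`isRT511_blockGauge` for (5.1.1)) and `C2.Eq5.2.6-5.2.8` ((5.2.8): p299755 + p300110) of `HOME/lit-balaban-r16/ROWS-C2-part2.md`.

THE PRINTED TEXT (p. 279 [PDF 23], verbatim).  *"Let us remark that having imposed the axial gauge conditions, we resign from all but the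
following restricted block field gauge invariance: ψ_y → ψ_y e^{ie_kλ(y)}, φ_x → φ_x e^{ie_k(Q′*λ)(x)}, v_{b′} → v_{b′} e^{−ie_kL(∂^Lλ)(b′)}, u_b →
u_b e^{−ie_k(∂Q′*λ)(b)}, u_b^{(j)} → u_b^{(j)} exp(−ie_kL^jη(∂^{L^jη}Q′*_{k−j+1}λ)(b)), b ∈ Λ₁^{(j)*c} only. (5.2.9)  These transformations
represent exactly the gauge invariance that was not broken by the axial gauge conditions but was broken by the renormalization
transformation. By compensating with transformations of the block fields v, ψ, we again have an invariance. This restricted gauge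
invariance we intend to preserve in all subsequent operations. For example, it is easily seen that the characteristic functions we have
inserted are invariant."*

READING (group level, as r18's `BIJ88BlockGauge417` and gen 5's `BIJ88RT51BlockGauge`): `λ` on the block lattice `T_L^{(k+1)}` ↔ `g = e^{ie_kλ} :
T_L^{(k+1)} → U(1)`; `Q′*λ` is block-constant, so `u`, `φ` on `T₁^{(k)}` move by `g∘blockOf` (`gaugeAct`, `twist`), `v ↦ v^g`, `ψ ↦ gψ`; the
fifth map is a `Π𝒟u^{(j)}`-preserving measurable reparametrization `τ` of the earlier fields (shape `BIJ88RT51NoChange.mulRightPrev`); the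
background objects of a term — `Q(u_k)φ` and the bond products `ū_k` of (4.4) — are data with the induced transformation law
(*"The dependence of u_k and u and the u^{(j)} is such that the above transformations induce the gauge transformation u_{k,b} → …"*, p. 277):
`Q(τ{u^{(j)}}, u^{g∘y}, (g∘y)φ) = g·Q({u^{(j)}}, u, φ)`, `ū(τ{u^{(j)}}, u^{g∘y})_b = g(y(b₋)) ū_b g(y(b₊))⁻¹`.

WHAT IS PROVED, and how.
* §1 `term_blockGauge`: the substitution `u → u^{g∘y}` (any `u`-measure invariant under block-constant gauge transformations), `{u^{(j)}} →
  τ{u^{(j)}}`, `φ → (g∘y)φ`, `ψ → gψ` in ONE term of the `ψ`-dependent display, the test function absorbing the inverse transformation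
  (gen 5's `uIntegral_blockGauge` with the integrand now seeing `ψ`: its invariance is used after the `ψ`-substitution; the Gaussian is
  rotation invariant, r18's `gaussWeight_twist`).
* §2 **`isRD_blockGauge`** (any invariant `ν`), **`isRD_blockGauge_field`** (`ν = 𝒟u`, r18's `integral_comp_gaugeAct`),
  **`isRD_blockGauge_axial`** (`ν = 𝒟u δ_{Ax}`, r18's `integral_comp_gaugeAct_blockConst_axialMeasure` — *"does not affect the δ-functions
  giving the axial gauge conditions"*; standing range): if `ρ̃` satisfies `IsRD ν terms Qu Qφ a ρ` with block-gauge covariant `Qu` and `Q_t`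
  and jointly invariant `ρ_t` (w.r.t. `τ_t(g)`), then so does `(v, ψ) ↦ ρ̃(v^g, gψ)` — no measurability/integrability hypothesis.
* §3 *"the characteristic functions we have inserted are invariant"*: **`chi522_blockGauge`** — each printed `χ_x(|φ(x)|)`, `χ_y(|(ψ −
  Q(u_k)φ)(y)|)`, `χ_b(|(D_{ū_k}φ)(b)|)`, `χ_p(|u(p) − 1|)` takes the same value at the transformed configuration (phases of modulus one drop
  out of the norms; `|u(p) − 1|` is gauge invariant, r18's `cfg_gaugeAct` + `plaqVar_gauge`), given the covariance of `Q(u_k)φ` and `ū_k`;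
  hence `weight527_blockGauge` (`ζ_{Λ₀ᶜ}χ_{Λ₀}` invariant; `weight527_congr`: the weight is a polynomial in the `χ`-values), `covD_one_transf`.
* §4 **`density528_blockGauge`**: consequently every density satisfying the display (5.2.8) with the printed characteristic functions
  (file 2's data: `weight527 ∘ chi522` times `ρ′_t`) over `𝒟u δ_{Ax}` transforms covariantly: `(v, ψ) ↦ ρ̃(v^g, gψ)` satisfies the same display —
  (5.2.9) holds after the operation of Sect. 5.2.
NOT DONE HERE (honest scope).  The printed exponential factors on `Λ₁^{(j)*c}` for the `u^{(j)}` (the reparametrization `τ` is abstract, as in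
gen 5), the verification that the concrete `ρ′_k`, `u_k` of Sects. 4–5 have the assumed laws (r18's `backgroundU_blockGauge(_iter)`, gen 7's
`qCov_barU_blockGauge` cover the background parts), a.e. statements for a chosen version; no bound.  Theorems only; re-declares nothing;
imports Literature + Mathlib only; NO `Prop`-valued fact is introduced; standard axioms.
-/

namespace Literature.MathematicalPhysics.QuantumFieldTheory.BalabanImbrieJaffe1984to88.BIJ88RT52BlockGauge

open Literature.MathematicalPhysics.QuantumFieldTheory.Balaban1983to89
open BIJ88Sect3Statements (U1 toC cfg covD plaqVar plaqVar_gauge norm_toC)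
open BIJ85Sect1Model (HiggsField)
open BIJ85RT33 (twist twist_apply measurable_twist)
open BIJ88Sect5Statements (CutoffProfile cutoff)
open BIJ88Sect5StatementsPart3 (chiX chiY chiB chiP)
open BIJ88RenormTransf311 (axialMeasure gaussWeight cfg_gaugeAct)
open BIJ85BlockAveragesTorus (toC_ne_zero)
open BIJ88InductiveForm41 (Prev prevMeasure)
open BIJ88BlockGauge417 (integral_comp_gaugeAct integral_comp_gaugeAct_blockConst_axialMeasure gaugeAct_inv_gaugeAct twist_inv_twist
  integral_comp_twist gaussWeight_twist)
open BIJ88RT51BlockGauge (integral_blockGauge_test test_blockGauge)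
open BIJ88RT52Restrictions (Fields IsRD)
open BIJ88Eq528Density (Point Coeff522 chi522 weight527)
open GaugeField (gaugeAct)
open scoped BigOperators
open _root_.MeasureTheory _root_.MeasureTheory.Measure Complex Function

noncomputable section

variable {P : Params} {k : ℕ}

/-! ## §1 One term under a block field gauge transformation (`ψ`-dependent integrand) -/

/-- **One term of the `ψ`-dependent display under a block field gauge transformation** (gen 5's `uIntegral_blockGauge` with the integrand
seeing `ψ`): for a `u`-measure `μ` invariant under the block-constant gauge transformations `u ↦ u^{g∘y}`, block-gauge covariant `Qu`, a
`Π𝒟u^{(j)}`-preserving reparametrization `τ` under which (jointly with `u ↦ u^{g∘y}`, `φ ↦ (g∘y)φ`, `ψ ↦ gψ`) the integrand `ρ` is invariant and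
the background kernel covariant, the term tested against `(v, ψ) ↦ t(v^{g⁻¹}, g⁻¹ψ)` equals the term tested against `t`.
[cite: BalabanImbrieJaffe1988, (5.2.9) p.279] -/
theorem term_blockGauge {μ : Measure (GaugeField P k U1)} (g : GaugeTransf P (k+1) U1)
    (hμ : ∀ F : GaugeField P k U1 → ℂ, ∫ U, F (gaugeAct (fun x => g (blockOf x)) U) ∂μ = ∫ U, F U ∂μ)
    {Qu : GaugeField P k U1 → GaugeField P (k+1) U1} (hQu : ∀ U, Qu (gaugeAct (fun x => g (blockOf x)) U) = gaugeAct g (Qu U))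
    {Qφ₀ : Prev P k → GaugeField P k U1 → HiggsField P k → HiggsField P (k+1)} {a : ℝ}
    {ρ₀ : Prev P k → GaugeField P k U1 → HiggsField P k → HiggsField P (k+1) → ℂ}
    (τ : Prev P k ≃ᵐ Prev P k) (hτ : MeasurePreserving τ (prevMeasure P k) (prevMeasure P k))
    (hρ : ∀ prev U φ ψ,
      ρ₀ (τ prev) (gaugeAct (fun x => g (blockOf x)) U) (twist (fun x => g (blockOf x)) φ) (twist g ψ) = ρ₀ prev U φ ψ)
    (hQφ : ∀ prev U φ,
      Qφ₀ (τ prev) (gaugeAct (fun x => g (blockOf x)) U) (twist (fun x => g (blockOf x)) φ) = twist g (Qφ₀ prev U φ))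
    (t : GaugeField P (k+1) U1 × HiggsField P (k+1) → ℂ) :
    ∫ U, ∫ prev, ∫ φ, ∫ ψ, ρ₀ prev U φ ψ * (gaussWeight a (Qφ₀ prev U φ) ψ : ℂ) *
        t (gaugeAct (fun y => (g y)⁻¹) (Qu U), twist (fun y => (g y)⁻¹) ψ) ∂volume ∂volume ∂prevMeasure P k ∂μ =
      ∫ U, ∫ prev, ∫ φ, ∫ ψ, ρ₀ prev U φ ψ * (gaussWeight a (Qφ₀ prev U φ) ψ : ℂ) * t (Qu U, ψ)
        ∂volume ∂volume ∂prevMeasure P k ∂μ := by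
  -- `u → u^{g∘y}` under `μ`; `Q(u^{g∘y}) = (Qu)^g` cancels the inverse transformation in the test function
  rw [← hμ (fun U => ∫ prev, ∫ φ, ∫ ψ, ρ₀ prev U φ ψ * (gaussWeight a (Qφ₀ prev U φ) ψ : ℂ) *
    t (gaugeAct (fun y => (g y)⁻¹) (Qu U), twist (fun y => (g y)⁻¹) ψ) ∂volume ∂volume ∂prevMeasure P k)]
  refine integral_congr_ae (ae_of_all _ fun U => ?_)
  simp only [hQu U, gaugeAct_inv_gaugeAct]
  -- `{u^{(j)}} → τ{u^{(j)}}` under `Π𝒟u^{(j)}`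
  rw [← hτ.integral_comp' (fun prev => ∫ φ, ∫ ψ, ρ₀ prev (gaugeAct (fun x => g (blockOf x)) U) φ ψ *
    (gaussWeight a (Qφ₀ prev (gaugeAct (fun x => g (blockOf x)) U) φ) ψ : ℂ) * t (Qu U, twist (fun y => (g y)⁻¹) ψ))]
  refine integral_congr_ae (ae_of_all _ fun prev => ?_)
  dsimp only
  -- `φ → (g∘y)φ` under `𝒟φ`
  rw [← integral_comp_twist (fun x => g (blockOf x)) (fun φ => ∫ ψ, ρ₀ (τ prev) (gaugeAct (fun x => g (blockOf x)) U) φ ψ *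
    (gaussWeight a (Qφ₀ (τ prev) (gaugeAct (fun x => g (blockOf x)) U) φ) ψ : ℂ) * t (Qu U, twist (fun y => (g y)⁻¹) ψ))]
  refine integral_congr_ae (ae_of_all _ fun φ => ?_)
  simp only [hQφ prev U φ]
  -- `ψ → gψ` under `dψ`; now the integrand sees the fully transformed configuration and is invariant
  rw [← integral_comp_twist g (fun ψ => ρ₀ (τ prev) (gaugeAct (fun x => g (blockOf x)) U) (twist (fun x => g (blockOf x)) φ) ψ *
    (gaussWeight a (twist g (Qφ₀ prev U φ)) ψ : ℂ) * t (Qu U, twist (fun y => (g y)⁻¹) ψ))]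
  simp only [hρ, gaussWeight_twist, twist_inv_twist]

/-! ## §2 Block field gauge covariance of the `ψ`-dependent display -/

section Covariance

variable {ι : Type*} {terms : Finset ι} {ν : Measure (GaugeField P k U1)} {Qu : GaugeField P k U1 → GaugeField P (k+1) U1}
variable {Qφ : ι → Prev P k → GaugeField P k U1 → HiggsField P k → HiggsField P (k+1)} {a : ℝ}
variable {ρ : ι → Prev P k → GaugeField P k U1 → HiggsField P k → HiggsField P (k+1) → ℂ}
variable {ρL : GaugeField P (k+1) U1 → HiggsField P (k+1) → ℂ}

/-- **(5.2.9) for the `ψ`-dependent display, any invariant `u`-measure**: if `ρ̃` satisfies `IsRD ν terms Qu Qφ a ρ` with `ν` invariant under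
the block-constant gauge transformations, `Qu` block-gauge covariant, and for every term and every `g : T_L^{(k+1)} → U(1)` a
`Π𝒟u^{(j)}`-preserving reparametrization `τ_t(g)` under which the integrand `ρ_t({u^{(j)}}, u, φ, ψ)` is invariant and the background kernel
covariant, then `(v, ψ) ↦ ρ̃(v^g, gψ)` satisfies the same display (*"By compensating with transformations of the block fields v, ψ, we again
have an invariance"*). [cite: BalabanImbrieJaffe1988, (5.2.9) p.279] -/
theorem isRD_blockGauge
    (hν : ∀ (g : GaugeTransf P (k+1) U1) (F : GaugeField P k U1 → ℂ), ∫ U, F (gaugeAct (fun x => g (blockOf x)) U) ∂ν = ∫ U, F U ∂ν)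
    (hQu : ∀ (g : GaugeTransf P (k+1) U1) U, Qu (gaugeAct (fun x => g (blockOf x)) U) = gaugeAct g (Qu U))
    (τ : ι → GaugeTransf P (k+1) U1 → Prev P k ≃ᵐ Prev P k)
    (hτ : ∀ t ∈ terms, ∀ g, MeasurePreserving (τ t g) (prevMeasure P k) (prevMeasure P k))
    (hρ : ∀ t ∈ terms, ∀ (g : GaugeTransf P (k+1) U1) prev U φ ψ,
      ρ t (τ t g prev) (gaugeAct (fun x => g (blockOf x)) U) (twist (fun x => g (blockOf x)) φ) (twist g ψ) = ρ t prev U φ ψ)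
    (hQφ : ∀ t ∈ terms, ∀ (g : GaugeTransf P (k+1) U1) prev U φ,
      Qφ t (τ t g prev) (gaugeAct (fun x => g (blockOf x)) U) (twist (fun x => g (blockOf x)) φ) = twist g (Qφ t prev U φ))
    (h : IsRD ν terms Qu Qφ a ρ ρL) (g : GaugeTransf P (k+1) U1) :
    IsRD ν terms Qu Qφ a ρ (fun v ψ => ρL (gaugeAct g v) (twist g ψ)) := by
  intro t ht hb
  obtain ⟨hmeas, hbdd⟩ := test_blockGauge g ht hb
  rw [integral_blockGauge_test g ρL t, h _ hmeas hbdd]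
  exact Finset.sum_congr rfl fun i hi => term_blockGauge g (hν g) (hQu g) (τ i g) (hτ i hi g) (hρ i hi g) (hQφ i hi g) t

/-- **(5.2.9) for the display over `𝒟u`** (`𝒟u` is invariant under every gauge transformation, r18's `integral_comp_gaugeAct`).
[cite: BalabanImbrieJaffe1988, (5.2.9) p.279] -/
theorem isRD_blockGauge_field
    (hQu : ∀ (g : GaugeTransf P (k+1) U1) U, Qu (gaugeAct (fun x => g (blockOf x)) U) = gaugeAct g (Qu U))
    (τ : ι → GaugeTransf P (k+1) U1 → Prev P k ≃ᵐ Prev P k)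
    (hτ : ∀ t ∈ terms, ∀ g, MeasurePreserving (τ t g) (prevMeasure P k) (prevMeasure P k))
    (hρ : ∀ t ∈ terms, ∀ (g : GaugeTransf P (k+1) U1) prev U φ ψ,
      ρ t (τ t g prev) (gaugeAct (fun x => g (blockOf x)) U) (twist (fun x => g (blockOf x)) φ) (twist g ψ) = ρ t prev U φ ψ)
    (hQφ : ∀ t ∈ terms, ∀ (g : GaugeTransf P (k+1) U1) prev U φ,
      Qφ t (τ t g prev) (gaugeAct (fun x => g (blockOf x)) U) (twist (fun x => g (blockOf x)) φ) = twist g (Qφ t prev U φ))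
    (h : IsRD (fieldMeasure P k U1) terms Qu Qφ a ρ ρL) (g : GaugeTransf P (k+1) U1) :
    IsRD (fieldMeasure P k U1) terms Qu Qφ a ρ (fun v ψ => ρL (gaugeAct g v) (twist g ψ)) :=
  isRD_blockGauge (fun g' F => integral_comp_gaugeAct (fun x => g' (blockOf x)) F) hQu τ hτ hρ hQφ h g

/-- **(5.2.9) for the display over `∫𝒟u δ_{Ax}(u)(·)`** — the printed situation of (5.2.8): the block-constant gauge transformations do not
affect the axial gauge conditions (r18's `integral_comp_gaugeAct_blockConst_axialMeasure`; standing range `k + 1 ≤ m + K`).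
[cite: BalabanImbrieJaffe1988, (5.2.9) p.279] -/
theorem isRD_blockGauge_axial (hk : k + 1 ≤ P.m + P.K)
    (hQu : ∀ (g : GaugeTransf P (k+1) U1) U, Qu (gaugeAct (fun x => g (blockOf x)) U) = gaugeAct g (Qu U))
    (τ : ι → GaugeTransf P (k+1) U1 → Prev P k ≃ᵐ Prev P k)
    (hτ : ∀ t ∈ terms, ∀ g, MeasurePreserving (τ t g) (prevMeasure P k) (prevMeasure P k))
    (hρ : ∀ t ∈ terms, ∀ (g : GaugeTransf P (k+1) U1) prev U φ ψ,
      ρ t (τ t g prev) (gaugeAct (fun x => g (blockOf x)) U) (twist (fun x => g (blockOf x)) φ) (twist g ψ) = ρ t prev U φ ψ)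
    (hQφ : ∀ t ∈ terms, ∀ (g : GaugeTransf P (k+1) U1) prev U φ,
      Qφ t (τ t g prev) (gaugeAct (fun x => g (blockOf x)) U) (twist (fun x => g (blockOf x)) φ) = twist g (Qφ t prev U φ))
    (h : IsRD (axialMeasure P k U1) terms Qu Qφ a ρ ρL) (g : GaugeTransf P (k+1) U1) :
    IsRD (axialMeasure P k U1) terms Qu Qφ a ρ (fun v ψ => ρL (gaugeAct g v) (twist g ψ)) :=
  isRD_blockGauge (fun g' F => integral_comp_gaugeAct_blockConst_axialMeasure hk g' F) hQu τ hτ hρ hQφ h g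

end Covariance

/-! ## §3 *"it is easily seen that the characteristic functions we have inserted are invariant"* -/

section Invariance

variable {Qφ₀ : Prev P k → GaugeField P k U1 → HiggsField P k → HiggsField P (k+1)}
variable {ubar : Prev P k → GaugeField P k U1 → (PBond P k → ℂ)}

/-- kernel: the covariant derivative along the transformed data picks up only the phase at `b₋`:
`(D_{ū′}φ′)(b) = g(y(b₋))·(D_{ū}φ)(b)` for `ū′_b = g(y(b₋)) ū_b g(y(b₊))⁻¹`, `φ′ = (g∘y)φ`. [cite: BalabanImbrieJaffe1988, (5.2.9) p.279] -/
theorem covD_one_transf (g : GaugeTransf P (k+1) U1) (u : PBond P k → ℂ) (φ : HiggsField P k) (b : PBond P k) :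
    covD 1 (fun b' => toC (g (blockOf b'.src)) * u b' * (toC (g (blockOf b'.tgt)))⁻¹) (twist (fun x => g (blockOf x)) φ) b =
      toC (g (blockOf b.src)) * covD 1 u φ b := by
  have hne : toC (g (blockOf b.tgt)) ≠ 0 := toC_ne_zero _
  have e : toC (g (blockOf b.src)) * u b * (toC (g (blockOf b.tgt)))⁻¹ * (toC (g (blockOf b.tgt)) * φ b.tgt) =
      toC (g (blockOf b.src)) * u b * φ b.tgt := by
    rw [mul_assoc (toC (g (blockOf b.src)) * u b), inv_mul_cancel_left₀ hne]
  simp only [covD, twist_apply]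
  rw [e]
  ring

/-- **The printed characteristic functions (5.2.2) are invariant** under the block field gauge transformation of all the fields,
`(u, {u^{(j)}}, φ, ψ) ↦ (u^{g∘y}, τ{u^{(j)}}, (g∘y)φ, gψ)`, GIVEN the induced laws of the term's background data: `Q(u_k)φ` covariant (`↦ g·Q(u_k)φ`)
and the bond products `ū_k` of (4.4) covariant (`ū_b ↦ g(y(b₋)) ū_b g(y(b₊))⁻¹`) — `χ_x` sees `|φ(x)|`, `χ_y` sees `|ψ(y) − (Q(u_k)φ)(y)|`, `χ_b` sees
`|(D_{ū_k}φ)(b)|`, `χ_p` sees the gauge-invariant `|u(p) − 1|`; all phases have modulus one. [cite: BalabanImbrieJaffe1988, (5.2.9) p.279] -/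
theorem chi522_blockGauge (χ : CutoffProfile) (c : Coeff522) (g : GaugeTransf P (k+1) U1) (τ : Prev P k → Prev P k)
    (hQφ : ∀ prev U φ,
      Qφ₀ (τ prev) (gaugeAct (fun x => g (blockOf x)) U) (twist (fun x => g (blockOf x)) φ) = twist g (Qφ₀ prev U φ))
    (hubar : ∀ prev U, ubar (τ prev) (gaugeAct (fun x => g (blockOf x)) U) =
      fun b => toC (g (blockOf b.src)) * ubar prev U b * (toC (g (blockOf b.tgt)))⁻¹)
    (i : Point P k) (prev : Prev P k) (U : GaugeField P k U1) (φ : HiggsField P k) (ψ : HiggsField P (k+1)) :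
    chi522 χ c Qφ₀ ubar i (τ prev) (gaugeAct (fun x => g (blockOf x)) U) (twist (fun x => g (blockOf x)) φ) (twist g ψ) =
      chi522 χ c Qφ₀ ubar i prev U φ ψ := by
  rcases i with x | y | b | p
  · simp only [chi522, chiX, twist_apply, norm_mul, norm_toC, one_mul]
  · simp only [chi522, chiY, hQφ, twist_apply, ← mul_sub, norm_mul, norm_toC, one_mul]
  · simp only [chi522, chiB, hubar, covD_one_transf, norm_mul, norm_toC, one_mul]
  · simp only [chi522, chiP, cfg_gaugeAct, plaqVar_gauge]

/-- Hence **the weight `ζ_{Λ₀^{(k)c}} χ_{Λ₀^{(k)}}` of (5.2.6)–(5.2.7) is invariant** whenever the `χ`'s at the points are (it is a polynomial in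
their values). [cite: BalabanImbrieJaffe1988, (5.2.9) p.279] -/
theorem weight527_congr {ιp : Type*} [DecidableEq ιp] (S : Finset ιp) (Rmap : Finset ιp → Finset ιp)
    (χf : ιp → Prev P k → GaugeField P k U1 → HiggsField P k → HiggsField P (k+1) → ℝ) (Λ₀ : Finset ιp)
    {prev prev' : Prev P k} {U U' : GaugeField P k U1} {φ φ' : HiggsField P k} {ψ ψ' : HiggsField P (k+1)}
    (h : ∀ i, χf i prev' U' φ' ψ' = χf i prev U φ ψ) :
    weight527 S Rmap χf Λ₀ prev' U' φ' ψ' = weight527 S Rmap χf Λ₀ prev U φ ψ := by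
  simp only [weight527, h]

/-- The printed weight `ζ_{Λ₀^{(k)c}} χ_{Λ₀^{(k)}}` at the printed `χ_x, χ_y, χ_b, χ_p` is invariant under the block field gauge transformation of
all the fields (given the covariance of `Q(u_k)φ` and `ū_k`). [cite: BalabanImbrieJaffe1988, (5.2.9) p.279] -/
theorem weight527_blockGauge {ιp : Type*} [DecidableEq ιp] (S : Finset ιp) (Rmap : Finset ιp → Finset ιp) (pt : ιp → Point P k)
    (χ : CutoffProfile) (c : Coeff522) (g : GaugeTransf P (k+1) U1) (τ : Prev P k → Prev P k)
    (hQφ : ∀ prev U φ,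
      Qφ₀ (τ prev) (gaugeAct (fun x => g (blockOf x)) U) (twist (fun x => g (blockOf x)) φ) = twist g (Qφ₀ prev U φ))
    (hubar : ∀ prev U, ubar (τ prev) (gaugeAct (fun x => g (blockOf x)) U) =
      fun b => toC (g (blockOf b.src)) * ubar prev U b * (toC (g (blockOf b.tgt)))⁻¹)
    (Λ₀ : Finset ιp) (prev : Prev P k) (U : GaugeField P k U1) (φ : HiggsField P k) (ψ : HiggsField P (k+1)) :
    weight527 S Rmap (fun i => chi522 χ c Qφ₀ ubar (pt i)) Λ₀ (τ prev) (gaugeAct (fun x => g (blockOf x)) U)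
        (twist (fun x => g (blockOf x)) φ) (twist g ψ) =
      weight527 S Rmap (fun i => chi522 χ c Qφ₀ ubar (pt i)) Λ₀ prev U φ ψ :=
  weight527_congr S Rmap _ Λ₀ fun i => chi522_blockGauge χ c g τ hQφ hubar (pt i) prev U φ ψ

end Invariance

/-! ## §4 (5.2.9) holds after the operation of Sect. 5.2 -/

section After

variable {ι ιp : Type*} [DecidableEq ιp] {terms : Finset ι} {Qu : GaugeField P k U1 → GaugeField P (k+1) U1}
variable {Qφ : ι → Prev P k → GaugeField P k U1 → HiggsField P k → HiggsField P (k+1)} {a : ℝ}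
variable {ρ' : ι → Prev P k → GaugeField P k U1 → HiggsField P k → ℂ} {ρL : GaugeField P (k+1) U1 → HiggsField P (k+1) → ℂ}

/-- **(5.2.9) FOR THE (5.2.8) DENSITY** p. 279 [PDF 23]: *"This restricted gauge invariance we intend to preserve in all subsequent operations.
For example, it is easily seen that the characteristic functions we have inserted are invariant."* — PROVED at measure level: if `ρ̃` satisfies
the display (5.2.8) with the PRINTED characteristic functions (file 2's data: terms × regions, integrand `ζ_{Λ₀ᶜ}χ_{Λ₀} · ρ′_t` with
`weight527 ∘ chi522`, over `∫𝒟u δ_{Ax}(u)(·)`), with block-gauge covariant `Qu` (printed (2.10): r18's `qU_gaugeAct_blockConst`) and, for every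
term and `g`, a `Π𝒟u^{(j)}`-preserving reparametrization `τ_t(g)` under which `ρ′_t` is invariant, `Q(u_k)φ` covariant and `ū_k` covariant, then
`(v, ψ) ↦ ρ̃(v^g, gψ)` satisfies the same display (standing range). [cite: BalabanImbrieJaffe1988, (5.2.9) p.279] -/
theorem density528_blockGauge (hk : k + 1 ≤ P.m + P.K)
    (hQu : ∀ (g : GaugeTransf P (k+1) U1) U, Qu (gaugeAct (fun x => g (blockOf x)) U) = gaugeAct g (Qu U))
    (τ : ι → GaugeTransf P (k+1) U1 → Prev P k ≃ᵐ Prev P k)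
    (hτ : ∀ t ∈ terms, ∀ g, MeasurePreserving (τ t g) (prevMeasure P k) (prevMeasure P k))
    (hρ : ∀ t ∈ terms, ∀ (g : GaugeTransf P (k+1) U1) prev U φ,
      ρ' t (τ t g prev) (gaugeAct (fun x => g (blockOf x)) U) (twist (fun x => g (blockOf x)) φ) = ρ' t prev U φ)
    (hQφ : ∀ t ∈ terms, ∀ (g : GaugeTransf P (k+1) U1) prev U φ,
      Qφ t (τ t g prev) (gaugeAct (fun x => g (blockOf x)) U) (twist (fun x => g (blockOf x)) φ) = twist g (Qφ t prev U φ))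
    (χ : CutoffProfile) (c : Coeff522) {ubar : ι → Prev P k → GaugeField P k U1 → (PBond P k → ℂ)}
    (hubar : ∀ t ∈ terms, ∀ (g : GaugeTransf P (k+1) U1) prev U, ubar t (τ t g prev) (gaugeAct (fun x => g (blockOf x)) U) =
      fun b => toC (g (blockOf b.src)) * ubar t prev U b * (toC (g (blockOf b.tgt)))⁻¹)
    (S : ι → Finset ιp) (pt : ι → ιp → Point P k) (Rmap : ι → Finset ιp → Finset ιp)
    (h : IsRD (axialMeasure P k U1) (terms.sigma fun t => (S t).powerset.image (Rmap t)) Qu (fun tr => Qφ tr.1) a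
      (fun tr prev U φ ψ =>
        (weight527 (S tr.1) (Rmap tr.1) (fun i => chi522 χ c (Qφ tr.1) (ubar tr.1) (pt tr.1 i)) tr.2 prev U φ ψ : ℂ) *
          ρ' tr.1 prev U φ) ρL)
    (g : GaugeTransf P (k+1) U1) :
    IsRD (axialMeasure P k U1) (terms.sigma fun t => (S t).powerset.image (Rmap t)) Qu (fun tr => Qφ tr.1) a
      (fun tr prev U φ ψ =>
        (weight527 (S tr.1) (Rmap tr.1) (fun i => chi522 χ c (Qφ tr.1) (ubar tr.1) (pt tr.1 i)) tr.2 prev U φ ψ : ℂ) *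
          ρ' tr.1 prev U φ)
      (fun v ψ => ρL (gaugeAct g v) (twist g ψ)) := by
  refine isRD_blockGauge_axial hk hQu (fun tr g => τ tr.1 g) (fun tr htr g => hτ tr.1 (Finset.mem_sigma.1 htr).1 g)
    (fun tr htr g prev U φ ψ => ?_) (fun tr htr g prev U φ => hQφ tr.1 (Finset.mem_sigma.1 htr).1 g prev U φ) h g
  have ht : tr.1 ∈ terms := (Finset.mem_sigma.1 htr).1
  rw [weight527_blockGauge (S tr.1) (Rmap tr.1) (pt tr.1) χ c g (τ tr.1 g) (hQφ tr.1 ht g) (hubar tr.1 ht g),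
    hρ tr.1 ht g prev U φ]

end After

end

end Literature.MathematicalPhysics.QuantumFieldTheory.BalabanImbrieJaffe1984to88.BIJ88RT52BlockGauge
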